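import Literature.IUT.LogVolume.ExplicitEstimatesCorollary52
import HarnessLib

/-!
# [ExpEst] Corollary 5.2, proof pp. 215–217: the real-number steps (P5), (P8) and the core of Claim 5.2A —
# PROVED at the number level

S. Mochizuki, I. Fesenko, Y. Hoshi, A. Minamide, W. Porowski, *Explicit estimates in inter-universal Teichmüller
theory*, Kodai Math. J. **45** (2022) 175–236 — [ExpEst], bib key `MochizukiEtAl2022` (D-0012 claim key, status
disputed) — proof of Cor. 5.2, p. 215 (P5) through p. 218 "This completes the proof of (C2)" (pdf p41.l9 – p45.l10 of
the cell render `…/abc-iut/plan/repair/lit/renders/MFHMP-ExplicitEstimates-Kodai2022-book-anonnd-eeiutp`; journal page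
= pdf page + 174). Cell abc-iut, seat lit-abc-explicitiut (gen 4). Companion of `ExplicitEstimatesCorollary52.lean`
(the constants `δ = Cor22.delta d`, `h_d(ε) = ExpEst.hd d ε`, conditions (C1)/(C2), and the last step
`expEst_final_fraction`) and of `ExplicitEstimatesPrimeChoice.lean` ((P1)–(P3)).

CONTENT (classical real analysis; TAKES NO SIDE on [IUTchIII] Cor. 3.12 — the one place where the disputed chain
enters the printed proof, "we may apply Theorem 5.1 … to conclude that `(1/6)·log(q) ≤ (1 + 20·d_mod/l)·(log(𝔡^{F_tpd})
+ log(𝔣^{F_tpd})) + 4.0881·d*_mod·l`" (p. 216), is the HYPOTHESIS `h51` of `claimP8` (and of `conditionC2_of_display` in the companion file), a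
real inequality between the numbers it relates; nothing is asserted about it):

* `condP5_numerics` — the contradiction in (P5) (p. 215): under (P1) and `h ≥ 10^30·d²`, "`h ≤ h^{1/2}·log(l)`" is
  impossible (print: `f(x) = x^{1/2} − 1.5·log(x) − 2·log(2δ)` is increasing on `[9, ∞)` and `f(10^30·d²) > 0`; the
  kernel route is the cruder `l ≤ h^{5/2}`, `5·log(x) < x` — the STATED contradiction is the printed one);
* `claimP8` — (P8) (p. 216) from the Theorem-5.1 display, (P1) and the (P3)-consequence "`(1/6)·h − (1/6)·log(q) ≤
  (1/6)·h^{1/2}·log(l)`", with "`20·d_mod ≤ d*_mod ≤ δ` and `4.0881·1.464 ≤ 5.985`";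
* `T52 d h := 71.82·δ²·h^{−1/2}·log(1.45δ·h)` and **Claim 5.2A** `claim52A` (p. 217): `h ≥ h_d(ε) ⟹ T52 d h ≤
  ε·(1 − 10⁻⁷)`, all `d ≥ 1`, proved as printed — monotonicity of `x^{−1/2}·log(1.45δ·x)` (`log_mul_div_sqrt_le`), the
  cases `d = 1`, `d = 2` (`claim52A_value` with `(A, a) = (3.4·10^30, 83)`, `(6·10^31, 87)`: "`log(1.45δ₁·h₁(1)) ≥ 83`",
  "`log(1.45δ₂·h₂(1)) ≥ 87`", "`x·(1 − log x) ≤ 1`") and `d ≥ 3` ("`x^{−1/2}·(1 + (6/83)·log x) ≤ 1`");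
  THIS FILE has the monotonicity step and the common value computation `claim52A_value`; the numerical inputs of the
  cases, the case `d ≥ 3`, **Claim 5.2B** and the derivation of **(C2)** are in the companion
  `ExplicitEstimatesCorollary52Claims.lean`.

Nothing here constructs Θ-data, exceptional sets or the prime `l` ((P1)–(P3): `ExplicitEstimatesPrimeChoice.lean`;
(P4): `ExplicitEstimatesFaltingsComparison*.lean`; (P6)/(P7): [GenEll] §3 / Def. 4.1, not here).
-/

noncomputable section

namespace Literature.IUT.LogVolume

namespace ExpEst

open Real Cor22

/-! ## 0. Elementary real-analysis lemmas -/

/-- `log u ≤ 2(√u − 1)` for `u > 0` (`log √u ≤ √u − 1`). Auxiliary. [folklore] -/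
private theorem log_le_two_mul_sqrt_sub_one {u : ℝ} (hu : 0 < u) :
    Real.log u ≤ 2 * (Real.sqrt u - 1) := by
  have h := Real.log_le_sub_one_of_pos (Real.sqrt_pos.mpr hu)
  rw [Real.log_sqrt hu.le] at h
  linarith

/-- "the fact that `x·(1 − log(x)) ≤ 1` for all `x ∈ ℝ_{>0}`" (proof of Claim 5.2A, p. 217).
[cite: MochizukiEtAl2022, Cor 5.2 proof p. 217] -/
theorem mul_one_sub_log_le_one {t : ℝ} (ht : 0 < t) : t * (1 - Real.log t) ≤ 1 := by
  have h := Real.one_sub_inv_le_log_of_pos ht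
  have h2 : t * (1 - Real.log t) ≤ t * t⁻¹ := mul_le_mul_of_nonneg_left (by linarith) ht.le
  rwa [mul_inv_cancel₀ ht.ne'] at h2

/-- "since [as is easily verified] the function `x^{−1/2}·log(1.45δ·x)` is monotonically decreasing" (proof of Claim
5.2A, p. 217) — in the range where it is used: for `0 < Y ≤ X` with `1.45δ·Y ≥ e²` (here `c = 1.45δ`),
`log(c·X)/√X ≤ log(c·Y)/√Y` (`log(X/Y) ≤ 2(√(X/Y) − 1) ≤ (√(X/Y) − 1)·log(cY)`). [cite: MochizukiEtAl2022, Cor 5.2 proof p. 217] -/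
theorem log_mul_div_sqrt_le {c X Y : ℝ} (hY : 0 < Y) (hXY : Y ≤ X) (hc : Real.exp 2 ≤ c * Y) :
    Real.log (c * X) / Real.sqrt X ≤ Real.log (c * Y) / Real.sqrt Y := by
  have hX : 0 < X := lt_of_lt_of_le hY hXY
  have hcY : 0 < c * Y := lt_of_lt_of_le (Real.exp_pos 2) hc
  have hL : 2 ≤ Real.log (c * Y) := by rw [Real.le_log_iff_exp_le hcY]; exact hc
  set u : ℝ := X / Y with hu
  have hu0 : 0 < u := div_pos hX hY
  have hu1 : 1 ≤ u := (one_le_div hY).mpr hXY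
  have hXu : X = u * Y := by rw [hu]; field_simp
  have hsu : Real.sqrt X = Real.sqrt u * Real.sqrt Y := by rw [hXu, Real.sqrt_mul hu0.le]
  have hlogX : Real.log (c * X) = Real.log (c * Y) + Real.log u := by
    rw [hXu, show c * (u * Y) = (c * Y) * u by ring, Real.log_mul hcY.ne' hu0.ne']
  have hsu1 : 1 ≤ Real.sqrt u := by
    rw [show (1 : ℝ) = Real.sqrt 1 from Real.sqrt_one.symm]
    exact Real.sqrt_le_sqrt hu1
  have hlogu := log_le_two_mul_sqrt_sub_one hu0
  have hY' : 0 < Real.sqrt Y := Real.sqrt_pos.mpr hY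
  have hX' : 0 < Real.sqrt X := Real.sqrt_pos.mpr hX
  rw [div_le_div_iff₀ hX' hY', hlogX, hsu]
  have key : Real.log u ≤ (Real.sqrt u - 1) * Real.log (c * Y) := by nlinarith
  nlinarith [mul_le_mul_of_nonneg_right key hY'.le]

/-- Tangent-line bound at `2^n`: `log t ≤ n·log 2 − 1 + t/2^n` (`t > 0`; `log(t/2^n) ≤ t/2^n − 1`). Auxiliary
numerics. [folklore] -/
private theorem log_le_tangent (n : ℕ) {t : ℝ} (ht : 0 < t) :
    Real.log t ≤ n * Real.log 2 - 1 + t / 2 ^ n := by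
  have h2 : (0 : ℝ) < 2 ^ n := by positivity
  have h := Real.log_le_sub_one_of_pos (div_pos ht h2)
  rw [Real.log_div ht.ne' h2.ne', Real.log_pow] at h
  linarith

/-- `n·log 2 ≤ log t` for `2^n ≤ t`. Auxiliary numerics. [folklore] -/
private theorem natMul_log_two_le (n : ℕ) {t : ℝ} (ht : (2 : ℝ) ^ n ≤ t) : n * Real.log 2 ≤ Real.log t := by
  rw [← Real.log_pow]
  exact Real.log_le_log (by positivity) ht

/-- `a ≤ c·√A` from `a² ≤ c²·A` (`a, c, A ≥ 0`). Auxiliary numerics. [folklore] -/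
private theorem le_mul_sqrt_of_sq_le {a c A : ℝ} (ha : 0 ≤ a) (hc : 0 ≤ c) (h : a ^ 2 ≤ c ^ 2 * A) :
    a ≤ c * Real.sqrt A := by
  have h1 : Real.sqrt (a ^ 2) ≤ Real.sqrt (c ^ 2 * A) := Real.sqrt_le_sqrt h
  rwa [Real.sqrt_sq ha, Real.sqrt_mul (sq_nonneg c), Real.sqrt_sq hc] at h1

/-- "the fact that `5·log(x) < x` for all `x ∈ ℝ_{≥13}`" (p. 215), in the range `x ≥ 10^15` where it is applied.
[cite: MochizukiEtAl2022, Cor 5.2 proof p. 215] -/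
theorem five_mul_log_lt {s : ℝ} (hs : (10 : ℝ) ^ 15 ≤ s) : 5 * Real.log s < s := by
  have hs0 : 0 < s := lt_of_lt_of_le (by positivity) hs
  have h := log_le_tangent 50 hs0
  have h2 := Real.log_two_lt_d9
  norm_num at h h2 hs ⊢
  nlinarith

/-! ## 1. (P5): `𝕍^bad_mod ≠ ∅` — the numerical contradiction (p. 215) -/

/-- **(P5), the contradiction** (p. 215): "if `𝕍^bad_mod = ∅`, then it follows, in light of the definition of `h`, from
(P3) that `h ≤ h^{1/2}·log(l)`. In particular, [by (P1)] `h^{1/2} ≤ log(l) ≤ log(1.464δ) + 0.5·log(h) + log(log(1.45δ·h)) ≤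
… ≤ 1.5·log(h) + 2·log(2δ)` … `f(h) ≥ f(10^30·d²) … > 0` — a contradiction." Typed: for `d ≥ 1`, `h ≥ 10^30·d²` and `0 < l
≤ 1.464δ·h^{1/2}·log(1.45δ·h)` (`δ = Cor22.delta d`), one has `h^{1/2}·log(l) < h`. (Kernel route: `l ≤ h^{5/2}` and
`5·log(x) < x`.) [cite: MochizukiEtAl2022, Cor 5.2 proof (P5) p. 215] -/
theorem condP5_numerics {d : ℕ} (hd : 1 ≤ d) {h l : ℝ} (hh : (10 : ℝ) ^ 30 * (d : ℝ) ^ 2 ≤ h) (hl0 : 0 < l)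
    (hP1 : l ≤ 1.464 * delta d * Real.sqrt h * Real.log (1.45 * delta d * h)) :
    Real.sqrt h * Real.log l < h := by
  have hd1 : (1 : ℝ) ≤ d := by exact_mod_cast hd
  have hh0 : 0 < h := lt_of_lt_of_le (by positivity) hh
  set s : ℝ := Real.sqrt h with hsdef
  have hs2 : s ^ 2 = h := Real.sq_sqrt hh0.le
  have hs15 : (10 : ℝ) ^ 15 * d ≤ s := by
    have h1 : Real.sqrt (((10 : ℝ) ^ 15 * d) ^ 2) ≤ Real.sqrt h := Real.sqrt_le_sqrt (by nlinarith)
    rwa [Real.sqrt_sq (by positivity), ← hsdef] at h1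
  have hs15' : (10 : ℝ) ^ 15 ≤ s := le_trans (by nlinarith) hs15
  have hs0 : 0 < s := lt_of_lt_of_le (by positivity) hs15'
  have hδ : delta d = 552960 * d := delta_eq d
  have hδ0 : 0 < delta d := by rw [hδ]; positivity
  -- `δ ≤ 552960·10⁻¹⁵·s`
  have hδs : delta d ≤ 552960 / 10 ^ 15 * s := by rw [hδ]; nlinarith
  -- `l ≤ 1.464·1.45·δ²·s·h ≤ s^5`
  have hlog : Real.log (1.45 * delta d * h) ≤ 1.45 * delta d * h := by
    have := Real.log_le_sub_one_of_pos (show 0 < 1.45 * delta d * h by positivity)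
    linarith
  have hl1 : l ≤ 1.464 * delta d * s * (1.45 * delta d * h) :=
    hP1.trans (mul_le_mul_of_nonneg_left hlog (by positivity))
  have hl2 : l ≤ s ^ 5 := by
    rw [← hs2] at hl1
    have hδ2 : delta d ^ 2 ≤ (552960 / 10 ^ 15) ^ 2 * s ^ 2 := by nlinarith
    nlinarith [pow_pos hs0 3, pow_pos hs0 5]
  have hlogl : Real.log l ≤ 5 * Real.log s := by
    have e : Real.log (s ^ 5) = 5 * Real.log s := by
      rw [Real.log_pow]; norm_num
    rw [← e]
    exact Real.log_le_log hl0 hl2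
  have h5 := five_mul_log_lt hs15'
  rw [← hs2]
  nlinarith

/-! ## 2. (P8) (p. 216) -/

/-- **(P8)** (p. 216): from the Theorem-5.1 display as applied in (P7) — "`(1/6)·log(q) ≤ (1 + 20·d_mod/l)·(log(𝔡^{F_tpd}) +
log(𝔣^{F_tpd})) + 4.0881·d*_mod·l`" (HYPOTHESIS `h51`; `D := log(𝔡^{F_tpd}) + log(𝔣^{F_tpd}) ≥ 0`) — "(P1), as well as the
estimates `20·d_mod ≤ d*_mod ≤ δ` and `4.0881·1.464 ≤ 5.985`", and "it follows from (P3) that `(1/6)·h − (1/6)·log(q) ≤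
(1/6)·h^{1/2}·log(l)`" (HYPOTHESIS `hP3`): "`(1/6)·h·(1 − h^{−1/2}·log(l) − 35.91·δ²·h^{−1/2}·log(1.45δ·h)) ≤ (1 +
δ·h^{−1/2})·(log(𝔡^{F_tpd}) + log(𝔣^{F_tpd}))`". PROVED. [cite: MochizukiEtAl2022, Cor 5.2 proof (P8) p. 216] -/
theorem claimP8 {h l δ dmod dstar D logq : ℝ} (hh : 0 < h) (hs : Real.sqrt h ≤ l)
    (hP1 : l ≤ 1.464 * δ * Real.sqrt h * Real.log (1.45 * δ * h)) (hD : 0 ≤ D) (hdm : 0 ≤ dmod)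
    (h20 : 20 * dmod ≤ dstar) (hds : dstar ≤ δ) (hL : 0 ≤ Real.log (1.45 * δ * h))
    (h51 : 1 / 6 * logq ≤ (1 + 20 * dmod / l) * D + 4.0881 * dstar * l)
    (hP3 : 1 / 6 * h - 1 / 6 * logq ≤ 1 / 6 * Real.sqrt h * Real.log l) :
    1 / 6 * h * (1 - Real.log l / Real.sqrt h - 35.91 * δ ^ 2 * Real.log (1.45 * δ * h) / Real.sqrt h) ≤
      (1 + δ / Real.sqrt h) * D := by
  set s : ℝ := Real.sqrt h with hsdef
  set L : ℝ := Real.log (1.45 * δ * h) with hLdef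
  have hs0 : 0 < s := Real.sqrt_pos.mpr hh
  have hss : s * s = h := Real.mul_self_sqrt hh.le
  have hl0 : 0 < l := lt_of_lt_of_le hs0 hs
  have hδ0 : 0 ≤ δ := by linarith
  have hds0 : 0 ≤ dstar := by linarith
  -- `20·d_mod/l ≤ δ/h^{1/2}`
  have h1 : 20 * dmod / l ≤ δ / s := by
    rw [div_le_div_iff₀ hl0 hs0]
    nlinarith
  have h1' : (1 + 20 * dmod / l) * D ≤ (1 + δ / s) * D := by nlinarith
  -- `4.0881·d*_mod·l ≤ 5.985·δ²·h^{1/2}·log(1.45δh)`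
  have h2 : 4.0881 * dstar * l ≤ 5.985 * δ ^ 2 * s * L := by
    have := mul_le_mul_of_nonneg_left hP1 (show 0 ≤ 4.0881 * dstar by positivity)
    have hsL : 0 ≤ s * L := mul_nonneg hs0.le hL
    nlinarith [mul_le_mul_of_nonneg_right hds (by positivity : 0 ≤ δ * (s * L))]
  have e : 1 / 6 * h * (1 - Real.log l / s - 35.91 * δ ^ 2 * L / s) =
      1 / 6 * h - 1 / 6 * s * Real.log l - 5.985 * δ ^ 2 * s * L := by
    rw [← hss]
    field_simp
    ring
  rw [e]
  linarith

/-! ## 3. Claim 5.2A (p. 217) -/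

/-- The quantity of Claims 5.2A/5.2B: `T52 d h := 71.82·δ²·h^{−1/2}·log(1.45δ·h)` (`δ = Cor22.delta d`).
[cite: MochizukiEtAl2022, Cor 5.2 proof p. 217] -/
def T52 (d : ℕ) (h : ℝ) : ℝ := 71.82 * delta d ^ 2 * Real.log (1.45 * delta d * h) / Real.sqrt h

/-- `e² ≤ 1.45δ·h` whenever `h ≥ 1` (`δ ≥ 552960`): the range in which `x^{−1/2}·log(1.45δ·x)` decreases.
[cite: MochizukiEtAl2022, Cor 5.2 proof p. 217] -/
theorem exp_two_le {d : ℕ} (hd : 1 ≤ d) {h : ℝ} (hh : 1 ≤ h) : Real.exp 2 ≤ 1.45 * delta d * h := by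
  have hd1 : (1 : ℝ) ≤ d := by exact_mod_cast hd
  have he := Real.exp_one_lt_d9
  have he2 : Real.exp 2 = Real.exp 1 * Real.exp 1 := by rw [← Real.exp_add]; norm_num
  rw [he2, delta_eq]
  have he0 : 0 < Real.exp 1 := Real.exp_pos 1
  norm_num at he ⊢
  nlinarith

/-- Claim 5.2A reduced to `h = h_d(ε)`: for `h ≥ h_d(ε) (≥ 10^30·d² ≥ 1)`, `T52 d h ≤ T52 d (h_d(ε))` ("it suffices to show
that `71.82·δ²·h_d(ε)^{−1/2}·log(1.45δ·h_d(ε)) ≤ ε·(1 − 10⁻⁷)`", p. 217). [cite: MochizukiEtAl2022, Cor 5.2 proof p. 217] -/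
theorem T52_le_T52_hd {d : ℕ} (hd1 : 1 ≤ d) {ε : ℝ} (hε0 : 0 < ε) (hε1 : ε ≤ 1) {h : ℝ} (hh : hd d ε ≤ h) :
    T52 d h ≤ T52 d (hd d ε) := by
  have hd1' : (1 : ℝ) ≤ d := by exact_mod_cast hd1
  have hge := hd_ge hd1 hε0 hε1
  have hY1 : 1 ≤ hd d ε := le_trans (by nlinarith) hge
  have hY : 0 < hd d ε := by linarith
  unfold T52
  rw [mul_div_assoc, mul_div_assoc]
  refine mul_le_mul_of_nonneg_left ?_ (by positivity)
  exact log_mul_div_sqrt_le (c := 1.45 * delta d) hY hh (exp_two_le hd1 hY1)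

/-- **The value computation of Claim 5.2A** in the common shape of the cases `d = 1` (`A = 3.4·10^30`, `a = 83`, `h₁(ε) =
A·ε^{−166/81}`) and `d = 2` (`A = 6·10^31`, `a = 87`, `h₂(ε) = A·ε^{−174/85}`): with `t := ε^{2/(a−2)}`, "`71.82·δ²·h_d(ε)^{−1/2}·
log(1.45δ·h_d(ε)) = 71.82·δ²·h_d(1)^{−1/2}·log(1.45δ·h_d(1))·ε^{a/(a−2)}·(1 − log(ε^{2/(a−2)})·a/log(1.45δ·h_d(1))) ≤ ε·(1 −
10⁻⁷)·ε^{2/(a−2)}·(1 − log(ε^{2/(a−2)})) ≤ ε·(1 − 10⁻⁷)`, where we apply the estimate `log(1.45δ·h_d(1)) ≥ a` …; `0 < ε ≤ 1`;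
the fact that `x·(1 − log(x)) ≤ 1`" (p. 217). The two numerical inputs are the hypotheses `hL` (`log(1.45δ·A) ≥ a`) and
`hK` (`71.82·δ²·log(1.45δ·A) ≤ (1 − 10⁻⁷)·A^{1/2}`). [cite: MochizukiEtAl2022, Cor 5.2 proof p. 217] -/
theorem claim52A_value {A δ a ε : ℝ} (hA : 0 < A) (hδ : 0 < δ) (ha : 2 < a) (hε0 : 0 < ε) (hε1 : ε ≤ 1)
    (hL : a ≤ Real.log (1.45 * δ * A))
    (hK : 71.82 * δ ^ 2 * Real.log (1.45 * δ * A) ≤ (1 - 1 / 10 ^ 7) * Real.sqrt A) :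
    71.82 * δ ^ 2 * Real.log (1.45 * δ * (A * ε ^ (-(2 * a / (a - 2))))) /
        Real.sqrt (A * ε ^ (-(2 * a / (a - 2)))) ≤ ε * (1 - 1 / 10 ^ 7) := by
  have hb : 0 < a - 2 := by linarith
  set t : ℝ := ε ^ (2 / (a - 2)) with htdef
  have ht0 : 0 < t := Real.rpow_pos_of_pos hε0 _
  have ht1 : t ≤ 1 := Real.rpow_le_one hε0.le hε1 (by positivity)
  have hcA : 0 < 1.45 * δ * A := by positivity
  have hL0 : 0 < Real.log (1.45 * δ * A) := by linarith
  -- the power `E := ε^{−2a/(a−2)} = (ε·t)⁻²`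
  have hεt : 0 < ε * t := mul_pos hε0 ht0
  have hE : ε ^ (-(2 * a / (a - 2))) = ((ε * t) ^ 2)⁻¹ := by
    rw [Real.rpow_neg hε0.le]
    congr 1
    have e1 : 2 * a / (a - 2) = 2 + (2 / (a - 2)) * 2 := by field_simp; ring
    rw [e1, Real.rpow_add hε0, Real.rpow_mul hε0.le, Real.rpow_two, Real.rpow_two, htdef]
    ring
  have hE0 : 0 < ε ^ (-(2 * a / (a - 2))) := Real.rpow_pos_of_pos hε0 _
  -- `√(A·E) = √A/(ε t)` and `log(1.45δ·A·E) = L − 2·log(ε t)`, `2·log(ε t) = a·log t`... via `log ε = ((a−2)/2)·log t`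
  have hsqrt : Real.sqrt (A * ε ^ (-(2 * a / (a - 2)))) = Real.sqrt A / (ε * t) := by
    rw [hE, Real.sqrt_mul' A (by positivity), Real.sqrt_inv, Real.sqrt_sq hεt.le, div_eq_mul_inv]
  have hlogt : Real.log t = 2 / (a - 2) * Real.log ε := by rw [htdef, Real.log_rpow hε0]
  set L : ℝ := Real.log (1.45 * δ * A) with hLdef
  have hlogE : Real.log (1.45 * δ * (A * ε ^ (-(2 * a / (a - 2))))) = L - a * Real.log t := by
    rw [show 1.45 * δ * (A * ε ^ (-(2 * a / (a - 2)))) = (1.45 * δ * A) * ε ^ (-(2 * a / (a - 2))) by ring,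
      Real.log_mul hcA.ne' hE0.ne', Real.log_rpow hε0, hlogt, ← hLdef]
    field_simp
    ring
  rw [hsqrt, hlogE]
  have hsA : 0 < Real.sqrt A := Real.sqrt_pos.mpr hA
  rw [div_div_eq_mul_div, div_le_iff₀ hsA]
  -- goal: `71.82·δ²·(L − a·log t)·(ε·t) ≤ ε·(1 − 10⁻⁷)·√A`
  have hlt : Real.log t ≤ 0 := Real.log_nonpos ht0.le ht1
  -- `t·(L − a·log t) ≤ L·t·(1 − log t) ≤ L`
  have h1 : t * (L - a * Real.log t) ≤ L * (t * (1 - Real.log t)) := by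
    have : -(a * Real.log t) ≤ -(L * Real.log t) := by nlinarith
    nlinarith
  have h2 : t * (L - a * Real.log t) ≤ L := by
    have := mul_one_sub_log_le_one ht0
    nlinarith
  have h3 : 71.82 * δ ^ 2 * (L - a * Real.log t) * (ε * t) =
      ε * (71.82 * δ ^ 2) * (t * (L - a * Real.log t)) := by ring
  rw [h3]
  have h4 : ε * (71.82 * δ ^ 2) * (t * (L - a * Real.log t)) ≤ ε * (71.82 * δ ^ 2) * L :=
    mul_le_mul_of_nonneg_left h2 (by positivity)
  have h5 : ε * (71.82 * δ ^ 2) * L = ε * (71.82 * δ ^ 2 * L) := by ring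
  nlinarith [mul_le_mul_of_nonneg_left hK hε0.le]

end ExpEst

end Literature.IUT.LogVolume

end
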